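import Summits.ValiantsHypothesis.ValiantsHypothesis.Theorems.SymPencilPerFourInnerRankRows

/-!
# Route `SymPencil` — inner rank of the `2 | 2` row split of `per_4`: linear subspaces of the
# common isotropic cone (`--supports` stmt-ValiantsHypothesis-5674 `SdcSuperquadratic`; the
# (8,8) column of the size tables, isotropic-kernel route of `Cruxes/SdcSuperquadratic/INNER-RANK-TEN.md` §2)

For `a = 𝟙` the common isotropic cone of the four bilinear forms `(y₂,y₃) ↦ per (𝟙; e_l; y₂; y₃)`
is `𝒞 = {(y₂,y₃) : per (𝟙; e_l; y₂; y₃) = 0 ∀ l}`.  In the coordinates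
`p_l = 2 (y₂)_l - Σ y₂`, `p₄ = Σ y₂`, `q_l = 2 (y₃)_l - Σ y₃`, `q₄ = Σ y₃` it reads
`p_l q_l = p₄ q₄` (`l < 4`).

**Theorem** (`cone_dichotomies`).  If a linear subspace `W ≤ K⁴ × K⁴` of dimension `≥ 3` lies in
`𝒞`, then for each of the five indices `l ∈ {0,1,2,3,4}` one of the two linear functionals
`p_l`, `q_l` vanishes identically on `W`.  (So `W` is contained in `Y₂ ⊕ 0`, in `0 ⊕ Y₃`, or in
one of the twenty coordinate `3`-planes `{p_l = 0 (l ∈ T), q_l = 0 (l ∉ T)}`; this is the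
classification used by the isotropic-kernel route: for a joint `≤ 11`-square family
`Σ_r c_r t_r((a,b),(y₂,y₃))² = per (a; b; y₂; y₃)` the kernel of `y ↦ (t_r((a,0),y))_r` is such a
subspace of the cone at `a`, of dimension `≥ 3`.)

Proof.  Polarising `p_l q_l = p₄ q₄` on `W` gives one symmetric bilinear form
`φ(w,w') = p₄(w) q₄(w') + p₄(w') q₄(w)`.  If `φ ≡ 0`, each pair `(p_l, q_l)` satisfies
`p_l(w) q_l(w') + p_l(w') q_l(w) = 0`, which forces one of them to vanish on `W`.  If `φ ≢ 0`,
pick `w₀` with `p₄(w₀) q₄(w₀) ≠ 0`; then for every `w ∈ W` the five ratios `p_l(w)/p_l(w₀)` are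
roots of one quadratic, whence every `p_l(w)` and `q_l(w)` is a fixed linear combination of
`p₄(w), q₄(w)`: `W` embeds into `K²`, contradicting `dim W ≥ 3`.

Honest framing: an elementary linear-algebra lemma (no design, no permanent identity beyond the
row expansion); one input of a CONDITIONAL reduction of the cells `(8,8,10)`, `(8,8,11)`; the
window `27 ≤ sdc(per_4) ≤ 29`, the crux and `VP ≠ VNP` are untouched.  No definitions, no named
facts. [folklore]
-/

noncomputable section

-- single-conjunct layout: Sub = Summit, duplicated namespace component intended
set_option linter.dupNamespace false

namespace Summit.ValiantsHypothesis.ValiantsHypothesis.Theorems.SymPencilPerFourInnerRankIsotropicCone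

open Matrix Finset Module
open Summit.ValiantsHypothesis.ValiantsHypothesis.Theorems.SymPencilPerFourInnerRankRows

variable {K : Type*} [Field K]

/-- `per (𝟙; e_l; x; x') = (Σx - x_l)(Σx' - x'_l) - (x·x' - x_l x'_l)` (expansion along the row
`e_l`). [folklore] -/
theorem per_ones_single_rows (x x' : Fin 4 → K) (l : Fin 4) :
    (Matrix.of ![(fun _ => (1 : K)), Pi.single l 1, x, x']).permanent =
      ((x 0 + x 1 + x 2 + x 3) - x l) * ((x' 0 + x' 1 + x' 2 + x' 3) - x' l) -
        ((x 0 * x' 0 + x 1 * x' 1 + x 2 * x' 2 + x 3 * x' 3) - x l * x' l) := by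
  rw [permanent_of_rows]
  fin_cases l <;> simp <;> ring

/-- A product of two functions that vanishes "symmetrically" on a set vanishes factorwise:
if `f w g w' + f w' g w = 0` for all `w, w' ∈ S` then `f` or `g` vanishes on `S`
(characteristic `≠ 2`). [folklore] -/
theorem left_or_right_of_symm_prod [CharZero K] {M : Type*} (S : Set M) (f g : M → K)
    (h : ∀ w ∈ S, ∀ w' ∈ S, f w * g w' + f w' * g w = 0) :
    (∀ w ∈ S, f w = 0) ∨ (∀ w ∈ S, g w = 0) := by
  by_contra hne
  push Not at hne
  obtain ⟨⟨w₁, hw₁, hf⟩, ⟨w₂, hw₂, hg⟩⟩ := hne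
  have h11 := h w₁ hw₁ w₁ hw₁
  have hg1 : g w₁ = 0 := by
    have : (2 : K) * (f w₁ * g w₁) = 0 := by linear_combination h11
    rcases mul_eq_zero.1 this with h2 | h2
    · exact absurd h2 two_ne_zero
    · exact (mul_eq_zero.1 h2).resolve_left hf
  have h12 := h w₁ hw₁ w₂ hw₂
  rw [hg1, mul_zero, add_zero] at h12
  rcases mul_eq_zero.1 h12 with h' | h'
  · exact hf h'
  · exact hg h'

/-- The root dichotomy behind the anisotropic case: if `B u + A t = B₄ u₄ + A₄ t₄`,
`u t = u₄ t₄` and `A B = A₄ B₄`, then `(A₄ u - A u₄) (A B (A₄ u + A u₄) - (B₄ u₄ + A₄ t₄) A A₄) = 0`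
(both `u/A` and `u₄/A₄` are roots of the same quadratic). [folklore] -/
theorem root_dichotomy (A B A₄ B₄ u t u₄ t₄ : K) (e1 : B * u + A * t = B₄ * u₄ + A₄ * t₄)
    (e2 : u * t = u₄ * t₄) (e3 : A * B = A₄ * B₄) :
    (A₄ * u - A * u₄) * (A * B * (A₄ * u + A * u₄) - (B₄ * u₄ + A₄ * t₄) * A * A₄) = 0 := by
  linear_combination A * (A₄ ^ 2 * u * e1 - A * A₄ ^ 2 * e2 - A * u₄ ^ 2 * e3)

set_option maxHeartbeats 400000 in
/-- **Dichotomies for linear subspaces of the common isotropic cone at `a = 𝟙`.**  If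
`W ≤ K⁴ × K⁴` has dimension `≥ 3` and `per (𝟙; e_l; w.1; w.2) = 0` for all `w ∈ W` and all `l`,
then (`Σ w.1 ≡ 0` or `Σ w.2 ≡ 0` on `W`) and, for every `l`, (`2 w.1 l ≡ Σ w.1` or
`2 w.2 l ≡ Σ w.2` on `W`).  See the module docstring. [folklore] -/
theorem cone_dichotomies [CharZero K] (W : Submodule K ((Fin 4 → K) × (Fin 4 → K)))
    (hW : ∀ w ∈ W, ∀ l : Fin 4,
      (Matrix.of ![(fun _ => (1 : K)), Pi.single l 1, w.1, w.2]).permanent = 0)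
    (h3 : 3 ≤ finrank K W) :
    ((∀ w ∈ W, w.1 0 + w.1 1 + w.1 2 + w.1 3 = 0) ∨
        (∀ w ∈ W, w.2 0 + w.2 1 + w.2 2 + w.2 3 = 0)) ∧
      ∀ l : Fin 4, (∀ w ∈ W, 2 * w.1 l = w.1 0 + w.1 1 + w.1 2 + w.1 3) ∨
        (∀ w ∈ W, 2 * w.2 l = w.2 0 + w.2 1 + w.2 2 + w.2 3) := by
  -- the functionals
  set s₁ : ((Fin 4 → K) × (Fin 4 → K)) → K := fun w => w.1 0 + w.1 1 + w.1 2 + w.1 3 with hs₁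
  set s₂ : ((Fin 4 → K) × (Fin 4 → K)) → K := fun w => w.2 0 + w.2 1 + w.2 2 + w.2 3 with hs₂
  set P : Fin 4 → ((Fin 4 → K) × (Fin 4 → K)) → K := fun l w => 2 * w.1 l - s₁ w with hP
  set Q : Fin 4 → ((Fin 4 → K) × (Fin 4 → K)) → K := fun l w => 2 * w.2 l - s₂ w with hQ
  have s₁_add : ∀ w w', s₁ (w + w') = s₁ w + s₁ w' := fun w w' => by
    simp only [hs₁, Prod.fst_add, Pi.add_apply]; ring
  have s₂_add : ∀ w w', s₂ (w + w') = s₂ w + s₂ w' := fun w w' => by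
    simp only [hs₂, Prod.snd_add, Pi.add_apply]; ring
  have P_add : ∀ l w w', P l (w + w') = P l w + P l w' := fun l w w' => by
    simp only [hP, hs₁, Prod.fst_add, Pi.add_apply]; ring
  have Q_add : ∀ l w w', Q l (w + w') = Q l w + Q l w' := fun l w w' => by
    simp only [hQ, hs₂, Prod.snd_add, Pi.add_apply]; ring
  -- the cone in `p, q` coordinates: `P_l Q_l = s₁ s₂`
  have hPQ : ∀ w ∈ W, ∀ l, P l w * Q l w = s₁ w * s₂ w := by
    intro w hw l
    have h0 := hW w hw 0
    have h1 := hW w hw 1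
    have h2 := hW w hw 2
    have h3' := hW w hw 3
    rw [per_ones_single_rows] at h0 h1 h2 h3'
    have hl := hW w hw l
    rw [per_ones_single_rows] at hl
    simp only [hP, hQ, hs₁, hs₂]
    have hdot : w.1 0 * w.2 0 + w.1 1 * w.2 1 + w.1 2 * w.2 2 + w.1 3 * w.2 3 =
        (w.1 0 + w.1 1 + w.1 2 + w.1 3) * (w.2 0 + w.2 1 + w.2 2 + w.2 3) := by
      linear_combination (-(h0 + h1 + h2 + h3')) / 2
    linear_combination 2 * hl + 2 * hdot
  -- polarisation
  have hpol : ∀ w ∈ W, ∀ w' ∈ W, ∀ l,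
      P l w * Q l w' + P l w' * Q l w = s₁ w * s₂ w' + s₁ w' * s₂ w := by
    intro w hw w' hw' l
    have h := hPQ (w + w') (W.add_mem hw hw') l
    rw [P_add, Q_add, s₁_add, s₂_add] at h
    have h1 := hPQ w hw l
    have h2 := hPQ w' hw' l
    linear_combination h - h1 - h2
  by_cases hB : ∀ w ∈ W, s₁ w * s₂ w = 0
  · -- the isotropic case: every pair `(P_l, Q_l)` and `(s₁, s₂)` is a symmetric zero product
    have h4 : ∀ w ∈ W, ∀ w' ∈ W, s₁ w * s₂ w' + s₁ w' * s₂ w = 0 := by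
      intro w hw w' hw'
      have h := hB (w + w') (W.add_mem hw hw')
      rw [s₁_add, s₂_add] at h
      have h1 := hB w hw
      have h2 := hB w' hw'
      linear_combination h - h1 - h2
    refine ⟨left_or_right_of_symm_prod (W : Set _) s₁ s₂ h4, fun l => ?_⟩
    have hl : ∀ w ∈ W, ∀ w' ∈ W, P l w * Q l w' + P l w' * Q l w = 0 := by
      intro w hw w' hw'
      rw [hpol w hw w' hw' l]
      exact h4 w hw w' hw'
    rcases left_or_right_of_symm_prod (W : Set _) (P l) (Q l) hl with h | h
    · left
      intro w hw
      have := h w hw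
      simp only [hP, hs₁] at this
      linear_combination this
    · right
      intro w hw
      have := h w hw
      simp only [hQ, hs₂] at this
      linear_combination this
  · -- the anisotropic case contradicts `dim W ≥ 3`
    exfalso
    push Not at hB
    obtain ⟨w₀, hw₀, hne⟩ := hB
    have hA4 : s₁ w₀ ≠ 0 := fun h => hne (by rw [h, zero_mul])
    have hB4 : s₂ w₀ ≠ 0 := fun h => hne (by rw [h, mul_zero])
    have hA : ∀ l, P l w₀ ≠ 0 := fun l h => hne (by rw [← hPQ w₀ hw₀ l, h, zero_mul])
    have hBQ : ∀ l, Q l w₀ ≠ 0 := fun l h => hne (by rw [← hPQ w₀ hw₀ l, h, mul_zero])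
    -- every `P_l w` and `Q_l w` vanishes as soon as `s₁ w = s₂ w = 0`
    have hPzero : ∀ l, ∀ w ∈ W, s₁ w = 0 → s₂ w = 0 → P l w = 0 := by
      intro l
      -- the product of two linear functionals vanishes on `W`
      have key : ∀ w ∈ W, (s₁ w₀ * P l w - P l w₀ * s₁ w) *
          (P l w₀ * Q l w₀ * (s₁ w₀ * P l w + P l w₀ * s₁ w) -
            (s₂ w₀ * s₁ w + s₁ w₀ * s₂ w) * P l w₀ * s₁ w₀) = 0 := by
        intro w hw
        have e1 := hpol w hw w₀ hw₀ l
        exact root_dichotomy (P l w₀) (Q l w₀) (s₁ w₀) (s₂ w₀) (P l w) (Q l w) (s₁ w) (s₂ w)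
          (by linear_combination e1) (hPQ w hw l) (hPQ w₀ hw₀ l)
      -- polarise the product
      obtain ⟨f, hf⟩ : ∃ f : ((Fin 4 → K) × (Fin 4 → K)) → K,
          ∀ w, f w = s₁ w₀ * P l w - P l w₀ * s₁ w := ⟨_, fun _ => rfl⟩
      obtain ⟨g, hg⟩ : ∃ g : ((Fin 4 → K) × (Fin 4 → K)) → K,
          ∀ w, g w = P l w₀ * Q l w₀ * (s₁ w₀ * P l w + P l w₀ * s₁ w) -
            (s₂ w₀ * s₁ w + s₁ w₀ * s₂ w) * P l w₀ * s₁ w₀ := ⟨_, fun _ => rfl⟩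
      have f_add : ∀ w w', f (w + w') = f w + f w' := fun w w' => by
        rw [hf, hf, hf, P_add, s₁_add]; ring
      have g_add : ∀ w w', g (w + w') = g w + g w' := fun w w' => by
        rw [hg, hg, hg, P_add, s₁_add, s₂_add]; ring
      have key' : ∀ w ∈ W, f w * g w = 0 := fun w hw => by rw [hf, hg]; exact key w hw
      have hfg : ∀ w ∈ W, ∀ w' ∈ W, f w * g w' + f w' * g w = 0 := by
        intro w hw w' hw'
        have h := key' (w + w') (W.add_mem hw hw')
        have h1 := key' w hw
        have h2 := key' w' hw'
        rw [f_add, g_add] at h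
        linear_combination h - h1 - h2
      intro w hw h1 h2
      rcases left_or_right_of_symm_prod (W : Set _) f g hfg with h | h
      · have h' := h w hw
        rw [hf, h1, mul_zero, sub_zero] at h'
        exact (mul_eq_zero.1 h').resolve_left hA4
      · have h' := h w hw
        rw [hg, h1, h2, mul_zero, mul_zero, add_zero, mul_zero, add_zero, zero_mul, zero_mul,
          sub_zero] at h'
        -- `h' : P l w₀ * Q l w₀ * (s₁ w₀ * P l w) = 0`
        have hne3 : P l w₀ * Q l w₀ * s₁ w₀ ≠ 0 := mul_ne_zero (mul_ne_zero (hA l) (hBQ l)) hA4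
        have h'' : (P l w₀ * Q l w₀ * s₁ w₀) * P l w = 0 := by linear_combination h'
        exact (mul_eq_zero.1 h'').resolve_left hne3
    have hQzero : ∀ l, ∀ w ∈ W, s₁ w = 0 → s₂ w = 0 → Q l w = 0 := by
      intro l
      have key : ∀ w ∈ W, (s₂ w₀ * Q l w - Q l w₀ * s₂ w) *
          (Q l w₀ * P l w₀ * (s₂ w₀ * Q l w + Q l w₀ * s₂ w) -
            (s₁ w₀ * s₂ w + s₂ w₀ * s₁ w) * Q l w₀ * s₂ w₀) = 0 := by
        intro w hw
        have e1 := hpol w hw w₀ hw₀ l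
        have e1' : P l w₀ * Q l w + Q l w₀ * P l w = s₁ w₀ * s₂ w + s₂ w₀ * s₁ w := by
          linear_combination e1
        have e2' : Q l w * P l w = s₂ w * s₁ w := by
          rw [mul_comm (Q l w), hPQ w hw l, mul_comm]
        have e3' : Q l w₀ * P l w₀ = s₂ w₀ * s₁ w₀ := by
          rw [mul_comm (Q l w₀), hPQ w₀ hw₀ l, mul_comm]
        exact root_dichotomy (Q l w₀) (P l w₀) (s₂ w₀) (s₁ w₀) (Q l w) (P l w) (s₂ w) (s₁ w)
          e1' e2' e3'
      obtain ⟨f, hf⟩ : ∃ f : ((Fin 4 → K) × (Fin 4 → K)) → K,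
          ∀ w, f w = s₂ w₀ * Q l w - Q l w₀ * s₂ w := ⟨_, fun _ => rfl⟩
      obtain ⟨g, hg⟩ : ∃ g : ((Fin 4 → K) × (Fin 4 → K)) → K,
          ∀ w, g w = Q l w₀ * P l w₀ * (s₂ w₀ * Q l w + Q l w₀ * s₂ w) -
            (s₁ w₀ * s₂ w + s₂ w₀ * s₁ w) * Q l w₀ * s₂ w₀ := ⟨_, fun _ => rfl⟩
      have f_add : ∀ w w', f (w + w') = f w + f w' := fun w w' => by
        rw [hf, hf, hf, Q_add, s₂_add]; ring
      have g_add : ∀ w w', g (w + w') = g w + g w' := fun w w' => by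
        rw [hg, hg, hg, Q_add, s₁_add, s₂_add]; ring
      have key' : ∀ w ∈ W, f w * g w = 0 := fun w hw => by rw [hf, hg]; exact key w hw
      have hfg : ∀ w ∈ W, ∀ w' ∈ W, f w * g w' + f w' * g w = 0 := by
        intro w hw w' hw'
        have h := key' (w + w') (W.add_mem hw hw')
        have h1 := key' w hw
        have h2 := key' w' hw'
        rw [f_add, g_add] at h
        linear_combination h - h1 - h2
      intro w hw h1 h2
      rcases left_or_right_of_symm_prod (W : Set _) f g hfg with h | h
      · have h' := h w hw
        rw [hf, h2, mul_zero, sub_zero] at h'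
        exact (mul_eq_zero.1 h').resolve_left hB4
      · have h' := h w hw
        rw [hg, h1, h2, mul_zero, mul_zero, add_zero, mul_zero, add_zero, zero_mul, zero_mul,
          sub_zero] at h'
        have hne3 : Q l w₀ * P l w₀ * s₂ w₀ ≠ 0 := mul_ne_zero (mul_ne_zero (hBQ l) (hA l)) hB4
        have h'' : (Q l w₀ * P l w₀ * s₂ w₀) * Q l w = 0 := by linear_combination h'
        exact (mul_eq_zero.1 h'').resolve_left hne3
    -- hence `w ↦ (s₁ w, s₂ w)` is injective on `W`: `dim W ≤ 2`
    have s₁_smul : ∀ (c : K) w, s₁ (c • w) = c * s₁ w := fun c w => by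
      simp only [hs₁, Prod.smul_fst, Pi.smul_apply, smul_eq_mul]; ring
    have s₂_smul : ∀ (c : K) w, s₂ (c • w) = c * s₂ w := fun c w => by
      simp only [hs₂, Prod.smul_snd, Pi.smul_apply, smul_eq_mul]; ring
    let L : ((Fin 4 → K) × (Fin 4 → K)) →ₗ[K] (K × K) :=
      { toFun := fun w => (s₁ w, s₂ w)
        map_add' := fun w w' => by rw [s₁_add, s₂_add]; rfl
        map_smul' := fun c w => by rw [s₁_smul, s₂_smul]; rfl }
    have hL : ∀ w, L w = (s₁ w, s₂ w) := fun w => rfl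
    have hinj : Function.Injective (L.comp W.subtype) := by
      rw [← LinearMap.ker_eq_bot, LinearMap.ker_eq_bot']
      intro w hw
      rw [LinearMap.comp_apply, Submodule.subtype_apply, hL] at hw
      have h1 : s₁ (w : (Fin 4 → K) × (Fin 4 → K)) = 0 := congr_arg Prod.fst hw
      have h2 : s₂ (w : (Fin 4 → K) × (Fin 4 → K)) = 0 := congr_arg Prod.snd hw
      have hw1 : ∀ l, (w : (Fin 4 → K) × (Fin 4 → K)).1 l = 0 := fun l => by
        have h := hPzero l w w.2 h1 h2
        simp only [hP] at h
        rw [h1, sub_zero] at h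
        exact (mul_eq_zero.1 h).resolve_left two_ne_zero
      have hw2 : ∀ l, (w : (Fin 4 → K) × (Fin 4 → K)).2 l = 0 := fun l => by
        have h := hQzero l w w.2 h1 h2
        simp only [hQ] at h
        rw [h2, sub_zero] at h
        exact (mul_eq_zero.1 h).resolve_left two_ne_zero
      apply Subtype.ext
      exact Prod.ext (funext hw1) (funext hw2)
    have hle := LinearMap.finrank_le_finrank_of_injective hinj
    rw [Module.finrank_prod, Module.finrank_self] at hle
    omega


/-- The torus scaling of the cone condition: `per (v; e_l; D x; D x') = (∏ v / v_l) · per (𝟙; e_l; x; x')`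
for `D = diag(v)`. [folklore] -/
theorem per_single_diag (v x x' : Fin 4 → K) (l : Fin 4) :
    v l * (Matrix.of ![v, Pi.single l 1, fun i => v i * x i, fun i => v i * x' i]).permanent =
      v 0 * v 1 * v 2 * v 3 *
        (Matrix.of ![(fun _ => (1 : K)), Pi.single l 1, x, x']).permanent := by
  rw [permanent_of_rows, permanent_of_rows]
  fin_cases l <;> simp <;> ring

/-- **Dichotomies for linear subspaces of the common isotropic cone at a general `a = v` with
non-zero coordinates** (transport of `cone_dichotomies` along `diag(v)`): if `W ≤ K⁴ × K⁴` has
dimension `≥ 3` and `per (v; e_l; w.1; w.2) = 0` for all `w ∈ W` and all `l`, then in the rescaled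
coordinates `w.1 i / v i`, `w.2 i / v i` the five dichotomies of `cone_dichotomies` hold. [folklore] -/
theorem cone_dichotomies_diag [CharZero K] (v : Fin 4 → K) (hv : ∀ i, v i ≠ 0)
    (W : Submodule K ((Fin 4 → K) × (Fin 4 → K)))
    (hW : ∀ w ∈ W, ∀ l : Fin 4, (Matrix.of ![v, Pi.single l 1, w.1, w.2]).permanent = 0)
    (h3 : 3 ≤ finrank K W) :
    ((∀ w ∈ W, w.1 0 / v 0 + w.1 1 / v 1 + w.1 2 / v 2 + w.1 3 / v 3 = 0) ∨
        (∀ w ∈ W, w.2 0 / v 0 + w.2 1 / v 1 + w.2 2 / v 2 + w.2 3 / v 3 = 0)) ∧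
      ∀ l : Fin 4,
        (∀ w ∈ W, 2 * (w.1 l / v l) = w.1 0 / v 0 + w.1 1 / v 1 + w.1 2 / v 2 + w.1 3 / v 3) ∨
        (∀ w ∈ W, 2 * (w.2 l / v l) = w.2 0 / v 0 + w.2 1 / v 1 + w.2 2 / v 2 + w.2 3 / v 3) := by
  -- the rescaling `x ↦ (x i / v i)_i` as a linear equivalence, and the rescaled subspace
  let D : (Fin 4 → K) ≃ₗ[K] (Fin 4 → K) :=
    { toFun := fun x i => x i / v i
      invFun := fun x i => v i * x i
      map_add' := fun x y => by funext i; simp only [Pi.add_apply]; ring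
      map_smul' := fun c x => by funext i; simp only [Pi.smul_apply, smul_eq_mul, RingHom.id_apply]; ring
      left_inv := fun x => by funext i; have := hv i; simp only; field_simp
      right_inv := fun x => by funext i; have := hv i; simp only; field_simp }
  have hD : ∀ x i, D x i = x i / v i := fun x i => rfl
  have hDinv : ∀ x i, v i * D x i = x i := fun x i => by have := hv i; rw [hD]; field_simp
  let DD := D.prodCongr D
  set W' : Submodule K ((Fin 4 → K) × (Fin 4 → K)) := W.map (DD : _ →ₗ[K] _) with hW'def
  have hmem : ∀ w' ∈ W', ∃ w ∈ W, w' = (D w.1, D w.2) := by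
    intro w' hw'
    rw [hW'def, Submodule.mem_map] at hw'
    obtain ⟨w, hw, rfl⟩ := hw'
    exact ⟨w, hw, rfl⟩
  have hmem' : ∀ w ∈ W, ((D w.1, D w.2) : (Fin 4 → K) × (Fin 4 → K)) ∈ W' := by
    intro w hw
    rw [hW'def, Submodule.mem_map]
    exact ⟨w, hw, rfl⟩
  -- the rescaled subspace lies in the cone at `𝟙`
  have hW' : ∀ w' ∈ W', ∀ l : Fin 4,
      (Matrix.of ![(fun _ => (1 : K)), Pi.single l 1, w'.1, w'.2]).permanent = 0 := by
    intro w' hw' l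
    obtain ⟨w, hw, rfl⟩ := hmem w' hw'
    have h := hW w hw l
    have hx : w.1 = fun i => v i * D w.1 i := by funext i; rw [hDinv]
    have hx' : w.2 = fun i => v i * D w.2 i := by funext i; rw [hDinv]
    rw [hx, hx'] at h
    have hper := per_single_diag v (D w.1) (D w.2) l
    rw [h, mul_zero] at hper
    have hc : v 0 * v 1 * v 2 * v 3 ≠ 0 :=
      mul_ne_zero (mul_ne_zero (mul_ne_zero (hv 0) (hv 1)) (hv 2)) (hv 3)
    exact (mul_eq_zero.1 hper.symm).resolve_left hc
  have h3' : 3 ≤ finrank K W' := by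
    rw [hW'def, LinearEquiv.finrank_map_eq]; exact h3
  obtain ⟨hA, hB⟩ := cone_dichotomies W' hW' h3'
  refine ⟨?_, fun l => ?_⟩
  · rcases hA with h | h
    · left; intro w hw; have := h _ (hmem' w hw); simpa [hD] using this
    · right; intro w hw; have := h _ (hmem' w hw); simpa [hD] using this
  · rcases hB l with h | h
    · left; intro w hw; have := h _ (hmem' w hw); simpa [hD] using this
    · right; intro w hw; have := h _ (hmem' w hw); simpa [hD] using this

end Summit.ValiantsHypothesis.ValiantsHypothesis.Theorems.SymPencilPerFourInnerRankIsotropicCone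

end
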